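import Summits.Ventures.HodgeRepro2.T5SU11ResolventDerivativeGroundState

/-!
# The resolvent as a function of `μ`: `d/dμ (L − μ)⁻¹ g = (L − μ)⁻² g` on `W_1`

The spectral parameter is `μ = λ(λ − 2)`, i.e. `λ = 1 + √(μ + 1)` for `μ > −1`. Composing row 561's derivative in `λ`
(`(2λ − 2) · G^I_λ(G^I_λ g)(t)`) with `dλ/dμ = 1/(2√(μ + 1)) = 1/(2(λ − 1))` gives the classical formula:

* `one_add_sqrt_eq`, `one_lt_one_add_sqrt`, `hasDerivAt_one_add_sqrt` — `λ(μ) = 1 + √(μ + 1)`: `λ(λ(λ − 2)) = λ` for `λ > 1`,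
  `λ(μ) > 1` for `μ > −1`, and `dλ/dμ = 1/(2√(μ + 1))`;
* `hasDerivAt_resolvent_mu` — **`μ ↦ G^I_{1 + √(μ+1)} g(t)` has derivative `G^I_{λ₂}(G^I_{λ₂} g)(t)` at `μ₂ = λ₂(λ₂ − 2)`**, for
  every `g ∈ W_1`, `λ₂ > 1`, `t > 0`: `d/dμ (L − μ)⁻¹ = (L − μ)⁻²`.

Nothing is claimed about (N).

Blind lane: Mathlib + the HodgeRepro2 prefix only; no sorry; axioms ⊆ {propext, Classical.choice,
Quot.sound}.
-/

namespace Summit.Ventures.HodgeRepro2.T5SU11ResolventDerivativeMu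

open Filter Topology MeasureTheory
open Set (Ioi Ioc)
open T5SU11Cartan T5SU11SphericalFunction T5SU11SphericalDecay T5SU11RadialGreenImproper
  T5SU11ResolventDerivativeGroundState

/-- **The spectral parameter inverted**: `1 + √(λ(λ − 2) + 1) = λ` for `λ > 1` — `λ = 1 + √(μ + 1)` is the root `> 1` of
`λ(λ − 2) = μ`. -/
theorem one_add_sqrt_eq {lam : ℝ} (hlam : 1 < lam) : 1 + Real.sqrt (lam * (lam - 2) + 1) = lam := by
  have h : lam * (lam - 2) + 1 = (lam - 1) ^ 2 := by ring
  rw [h, Real.sqrt_sq (by linarith)]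
  ring

/-- `1 + √(μ + 1) > 1` for `μ > −1`. -/
theorem one_lt_one_add_sqrt {μ : ℝ} (hμ : -1 < μ) : 1 < 1 + Real.sqrt (μ + 1) := by
  have : 0 < Real.sqrt (μ + 1) := Real.sqrt_pos.mpr (by linarith)
  linarith

/-- **`dλ/dμ = 1/(2√(μ + 1))`** for `μ > −1`, `λ(μ) = 1 + √(μ + 1)`. -/
theorem hasDerivAt_one_add_sqrt {μ : ℝ} (hμ : -1 < μ) :
    HasDerivAt (fun μ : ℝ => 1 + Real.sqrt (μ + 1)) (1 / (2 * Real.sqrt (μ + 1))) μ := by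
  have h := (Real.hasDerivAt_sqrt (x := μ + 1) (by linarith)).comp μ ((hasDerivAt_id μ).add_const 1)
  have h' := h.const_add 1
  simpa using h'

section measure

variable [MeasurableSpace Circle] [BorelSpace Circle]

/-- **`d/dμ (L − μ)⁻¹ g = (L − μ)⁻² g` on `W_1`**: `μ ↦ G^I_{1+√(μ+1)} g(t)` has derivative `G^I_{λ₂}(G^I_{λ₂} g)(t)` at
`μ₂ = λ₂(λ₂ − 2)`, for every `λ₂ > 1`, `g ∈ W_1` and `t > 0`. -/
theorem hasDerivAt_resolvent_mu {lam₂ : ℝ} (hlam₂ : 1 < lam₂) {g : ℝ → ℝ} (hg : ContinuousOn g (Ioi 0))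
    {D : ℝ} (hD : ∀ s, 0 < s → |g s| ≤ D * sph 1 (hyp s)) {t : ℝ} (ht : 0 < t) :
    HasDerivAt (fun μ => greenSolI (fun t => sph (1 + Real.sqrt (μ + 1)) (hyp t)) (sphDecay (1 + Real.sqrt (μ + 1))) g t)
      (greenSolI (fun t => sph lam₂ (hyp t)) (sphDecay lam₂)
        (greenSolI (fun t => sph lam₂ (hyp t)) (sphDecay lam₂) g) t) (lam₂ * (lam₂ - 2)) := by
  have hμ : -1 < lam₂ * (lam₂ - 2) := by nlinarith
  have hinner := hasDerivAt_one_add_sqrt hμ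
  have houter := hasDerivAt_greenSolI_lam hlam₂ hg hD ht
  rw [← one_add_sqrt_eq hlam₂] at houter
  have hcomp := houter.comp (lam₂ * (lam₂ - 2)) hinner
  -- the chain rule constant `(2λ₂ − 2) · 1/(2√(μ₂ + 1)) = 1`
  have hsq : lam₂ * (lam₂ - 2) + 1 = (lam₂ - 1) ^ 2 := by ring
  have hsqrt : Real.sqrt (lam₂ * (lam₂ - 2) + 1) = lam₂ - 1 := by
    rw [hsq, Real.sqrt_sq (by linarith)]
  rw [one_add_sqrt_eq hlam₂] at hcomp
  refine hcomp.congr_deriv ?_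
  have h2 : 2 * (lam₂ - 1) ≠ 0 := by
    have : lam₂ - 1 ≠ 0 := by linarith
    positivity
  rw [show (2 * lam₂ - 2) = 2 * (lam₂ - 1) by ring, hsqrt, mul_one_div, mul_div_cancel_left₀ _ h2]

end measure

end Summit.Ventures.HodgeRepro2.T5SU11ResolventDerivativeMu
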